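import Summits.FinalStateConjecture.FinalStateConjecture.Theorems.TameCensorship.Negative.GenericityAndFails

/-!
# The scale and the normal form of Christodoulou-genericity; the conjunction has codimension zero
(negative-side support for crux `TameCensorship`, `stmt-FinalStateConjecture-10047`, cycle 2 of the
cdisprove seat)

Structural facts about `InitialDataSet.HasCodimAtLeastIn 𝓓 𝓔 m`
(`Literature/Geometry/Lorentzian/Genericity.lean`), the genericity notion of the crux
`PhotonSphereChannels.TameCensorship` and of the summit, recorded for provers (what must be built) and
refuters (what must be exhibited):

* `hasCodimAtLeastIn_zero_iff` — codimension `≥ 0` inside `𝓓` is exactly `𝓔 ⊆ 𝓓`;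
  `isChristodoulouGeneric_zero` — with parameter `0` every property is generic.
* `HasCodimAtLeastIn.of_succ`, `HasCodimAtLeastIn.mono_codim` — the scale is monotone in `m`
  (restrict an `(m+1)`-parameter escape to the coordinate subspace `ℝᵐ`, `padZero`).
* `hasCodimAtLeastIn_of_local`, `hasCodimAtLeastIn_of_local'`, `hasCodimAtLeastIn_iff_local` —
  LOCAL ESCAPES SUFFICE: a family jointly smooth, injective, admissible and non-exceptional merely for
  parameters in a ball `B(0, δ)` (joint smoothness asked only on `B(0, δ) × X`) is globalised by the
  squash map `c ↦ δ c / √(1 + ‖c‖²)` (`squash`); an equivalent formulation of the definition.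
  (Note for provers: `F c ≠ F 0` for `c ≠ 0` is automatic, but injectivity is an extra demand of the
  regularised definition — a cure that is even in `c` is not an admissible family.)
* `not_hasCodimAtLeastIn_of_trap` — the abstract LEVEL-SET TRAP: an observable `f`, continuous along
  smooth parameter curves of smooth families, with `f d = 0`, whose admissible zero set and whose
  admissible level sets `{|f| = ρ}` for arbitrarily small `ρ > 0` are exceptional, makes `𝓔` of
  codimension `0`: `HasCodimAtLeastIn 𝓓 𝓔 m` fails for every `m ≥ 1`. This is the exact shape of
  obstruction a refutation of a curve-generic statement must produce.
* `not_isChristodoulouGeneric_P_and_Q_codim`, `isChristodoulouGeneric_and_fails_all_codim` — applied to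
  the model of `GenericityAndFails.lean`: the conjunction `P ∧ Q` of two codimension-`≥ 1` generic
  properties has codimension ZERO (its exceptional set fails `HasCodimAtLeastIn univ … m` for every
  `m ≥ 1`), sharpening `isChristodoulouGeneric_and_fails` (`m = 1`). Raising the codimension bookkeeping
  cannot rescue the glue principle.
-/

noncomputable section

open Bundle TopologicalSpace Manifold Set
open scoped ContDiff Topology InnerProductSpace RealInnerProductSpace

namespace Summit.FinalStateConjecture.FinalStateConjecture.Theorems.TameCensorship.Negative

open Literature.Geometry.Lorentzian

section Abstract

variable {E : Type*} [NormedAddCommGroup E] [NormedSpace ℝ E] {H : Type*} [TopologicalSpace H]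
  {I : ModelWithCorners ℝ E H} {X : Type*} [TopologicalSpace X] [ChartedSpace H X]
  [IsManifold I ∞ X]

/-! ### Codimension `0` is no condition -/

/-- In Christodoulou's scale, codimension `≥ 0` inside `𝓓` is exactly the inclusion `𝓔 ⊆ 𝓓`
(the constant `0`-parameter family through `d`). -/
theorem hasCodimAtLeastIn_zero_iff (𝓓 𝓔 : Set (InitialDataSet I X)) :
    InitialDataSet.HasCodimAtLeastIn 𝓓 𝓔 0 ↔ 𝓔 ⊆ 𝓓 := by
  refine ⟨InitialDataSet.HasCodimAtLeastIn.subset, fun h d hd ↦ ?_⟩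
  refine ⟨fun _ ↦ d, InitialDataSet.isSmoothDataFamily_const 0 d, rfl, ?_, fun _ ↦ h hd, ?_⟩
  · intro a b _
    exact Subsingleton.elim a b
  · intro c hc
    exact absurd (Subsingleton.elim c 0) hc

/-- With codimension parameter `0` EVERY property is Christodoulou-generic. -/
theorem isChristodoulouGeneric_zero (𝓓 : Set (InitialDataSet I X)) (P : InitialDataSet I X → Prop) :
    InitialDataSet.IsChristodoulouGeneric 𝓓 P 0 :=
  (hasCodimAtLeastIn_zero_iff 𝓓 _).2 fun _ hd ↦ hd.1

/-! ### Monotonicity of the scale: codimension `≥ m + 1` implies codimension `≥ m` -/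

/-- The coordinate inclusion `ℝᵐ ↪ ℝᵐ⁺¹`, `c ↦ (c, 0)`. -/
def padZero (m : ℕ) (c : EuclideanSpace ℝ (Fin m)) : EuclideanSpace ℝ (Fin (m + 1)) :=
  ∑ i : Fin m, c i • EuclideanSpace.single (Fin.castSucc i) (1 : ℝ)

/-- The padded vector has the original coordinates on `Fin.castSucc`. -/
theorem padZero_apply_castSucc (m : ℕ) (c : EuclideanSpace ℝ (Fin m)) (j : Fin m) :
    padZero m c (Fin.castSucc j) = c j := by
  simp [padZero, Finset.sum_apply, Pi.single_apply, Fin.castSucc_inj, mul_ite]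

/-- Padding by zero is injective. -/
theorem padZero_injective (m : ℕ) : Function.Injective (padZero m) := by
  intro c c' h
  ext j
  have := congrArg (fun v ↦ v (Fin.castSucc j)) h
  simpa [padZero_apply_castSucc] using this

/-- Padding the zero vector gives zero. -/
theorem padZero_zero (m : ℕ) : padZero m 0 = 0 := by
  simp [padZero]

/-- Padding by zero is smooth (a finite sum of smooth maps). -/
theorem contDiff_padZero (m : ℕ) : ContDiff ℝ ∞ (padZero m) := by
  unfold padZero
  refine ContDiff.sum fun i _ ↦ ?_
  have h0 : ContDiff ℝ ∞ (fun c : EuclideanSpace ℝ (Fin m) ↦ c i) :=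
    contDiff_piLp_apply (p := 2) (i := i)
  exact h0.smul contDiff_const

/-- **Christodoulou's scale is monotone**: an exceptional set of codimension `≥ m + 1` has
codimension `≥ m` (restrict the `(m+1)`-parameter family to the coordinate subspace `ℝᵐ`). -/
theorem HasCodimAtLeastIn.of_succ {𝓓 𝓔 : Set (InitialDataSet I X)} {m : ℕ}
    (h : InitialDataSet.HasCodimAtLeastIn 𝓓 𝓔 (m + 1)) :
    InitialDataSet.HasCodimAtLeastIn 𝓓 𝓔 m := by
  intro d hd
  obtain ⟨F, hF, h0, hinj, hadm, hexc⟩ := h d hd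
  have hsm : ContMDiff (𝓘(ℝ, EuclideanSpace ℝ (Fin m)).prod I)
      (𝓘(ℝ, EuclideanSpace ℝ (Fin (m + 1))).prod I) ∞
      (fun p : EuclideanSpace ℝ (Fin m) × X ↦ (padZero m p.1, p.2)) :=
    ((contDiff_padZero m).contMDiff.comp contMDiff_fst).prodMk contMDiff_snd
  refine ⟨F ∘ padZero m, ⟨hF.1.comp hsm, hF.2.comp hsm⟩, ?_, hinj.comp (padZero_injective m),
    fun c ↦ hadm _, fun c hc ↦ hexc _ ?_⟩
  · simp [padZero_zero, h0]
  · intro h'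
    exact hc (padZero_injective m (by rw [h', padZero_zero]))

/-- Iterated monotonicity: codimension `≥ n` implies codimension `≥ m` for `m ≤ n`. -/
theorem HasCodimAtLeastIn.mono_codim {𝓓 𝓔 : Set (InitialDataSet I X)} {m n : ℕ} (hmn : m ≤ n)
    (h : InitialDataSet.HasCodimAtLeastIn 𝓓 𝓔 n) : InitialDataSet.HasCodimAtLeastIn 𝓓 𝓔 m := by
  obtain ⟨k, rfl⟩ := Nat.exists_eq_add_of_le hmn
  induction k with
  | zero => exact h
  | succ k ih => exact ih (Nat.le_add_right m k) (HasCodimAtLeastIn.of_succ h)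

/-! ### Local escape suffices: the normal form of a codimension-`m` escape -/

/-- The squash diffeomorphism `ℝᵐ → B(0, δ)`, `c ↦ δ c / √(1 + ‖c‖²)`. -/
def squash (m : ℕ) (δ : ℝ) (c : EuclideanSpace ℝ (Fin m)) : EuclideanSpace ℝ (Fin m) :=
  (δ / Real.sqrt (1 + ‖c‖ ^ 2)) • c

/-- `0 < 1 + ‖c‖²`. -/
theorem one_add_norm_sq_pos {m : ℕ} (c : EuclideanSpace ℝ (Fin m)) : 0 < 1 + ‖c‖ ^ 2 := by
  positivity

/-- The squash map fixes the origin. -/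
theorem squash_zero (m : ℕ) (δ : ℝ) : squash m δ 0 = 0 := by simp [squash]

/-- The squash map takes values in the open ball `B(0, δ)`. -/
theorem norm_squash_lt {m : ℕ} {δ : ℝ} (hδ : 0 < δ) (c : EuclideanSpace ℝ (Fin m)) :
    ‖squash m δ c‖ < δ := by
  have hs : 0 < Real.sqrt (1 + ‖c‖ ^ 2) := Real.sqrt_pos.2 (one_add_norm_sq_pos c)
  have hlt : ‖c‖ < Real.sqrt (1 + ‖c‖ ^ 2) := by
    rw [Real.lt_sqrt (norm_nonneg _)]
    linarith
  rw [squash, norm_smul, Real.norm_eq_abs, abs_of_pos (div_pos hδ hs), div_mul_eq_mul_div,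
    div_lt_iff₀ hs]
  exact mul_lt_mul_of_pos_left hlt hδ

/-- The squash map vanishes only at the origin. -/
theorem squash_eq_zero_iff {m : ℕ} {δ : ℝ} (hδ : 0 < δ) (c : EuclideanSpace ℝ (Fin m)) :
    squash m δ c = 0 ↔ c = 0 := by
  have hs : 0 < Real.sqrt (1 + ‖c‖ ^ 2) := Real.sqrt_pos.2 (one_add_norm_sq_pos c)
  rw [squash, smul_eq_zero, or_iff_right]
  exact (div_pos hδ hs).ne'

/-- The squash map is injective (compare norms, `r ↦ r²/(1+r²)` being injective on `r ≥ 0`,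
then cancel the common positive scalar). -/
theorem squash_injective {m : ℕ} {δ : ℝ} (hδ : 0 < δ) : Function.Injective (squash m δ) := by
  intro c c' h
  have hs : 0 < Real.sqrt (1 + ‖c‖ ^ 2) := Real.sqrt_pos.2 (one_add_norm_sq_pos c)
  have hs' : 0 < Real.sqrt (1 + ‖c'‖ ^ 2) := Real.sqrt_pos.2 (one_add_norm_sq_pos c')
  -- compare norms
  have hn := congrArg (fun v ↦ ‖v‖ ^ 2) h
  simp only [squash, norm_smul, Real.norm_eq_abs, abs_of_pos (div_pos hδ hs),
    abs_of_pos (div_pos hδ hs'), mul_pow, div_pow, Real.sq_sqrt (one_add_norm_sq_pos c).le,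
    Real.sq_sqrt (one_add_norm_sq_pos c').le] at hn
  have hnorm : ‖c‖ ^ 2 = ‖c'‖ ^ 2 := by
    have hδ2 : (0 : ℝ) < δ ^ 2 := by positivity
    field_simp at hn
    nlinarith [hn, norm_nonneg c, norm_nonneg c', hδ2]
  have hcoef : δ / Real.sqrt (1 + ‖c‖ ^ 2) = δ / Real.sqrt (1 + ‖c'‖ ^ 2) := by rw [hnorm]
  rw [squash, squash, hcoef] at h
  exact smul_right_injective _ (div_pos hδ hs').ne' h

/-- The squash map is smooth (`√(1 + ‖c‖²)` never vanishes). -/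
theorem contDiff_squash (m : ℕ) (δ : ℝ) : ContDiff ℝ ∞ (squash m δ) := by
  have h1 : ContDiff ℝ ∞ (fun c : EuclideanSpace ℝ (Fin m) ↦ 1 + ‖c‖ ^ 2) :=
    contDiff_const.add (contDiff_norm_sq ℝ)
  have h2 : ContDiff ℝ ∞ (fun c : EuclideanSpace ℝ (Fin m) ↦ Real.sqrt (1 + ‖c‖ ^ 2)) :=
    h1.sqrt fun c ↦ (one_add_norm_sq_pos c).ne'
  have h3 : ContDiff ℝ ∞ (fun c : EuclideanSpace ℝ (Fin m) ↦ δ / Real.sqrt (1 + ‖c‖ ^ 2)) :=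
    contDiff_const.div h2 fun c ↦ (Real.sqrt_pos.2 (one_add_norm_sq_pos c)).ne'
  exact h3.smul contDiff_id

/-- Precomposing a family that is jointly smooth for parameters in the ball `B(0, δ)` with the
squash map gives a globally smooth family (`IsSmoothDataFamily`). -/
theorem isSmoothDataFamily_comp_squash {m : ℕ} {δ : ℝ} (hδ : 0 < δ)
    {F : EuclideanSpace ℝ (Fin m) → InitialDataSet I X}
    (hh : ContMDiffOn (𝓘(ℝ, EuclideanSpace ℝ (Fin m)).prod I) (I.prod 𝓘(ℝ, E →L[ℝ] E →L[ℝ] ℝ)) ∞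
      (fun p : EuclideanSpace ℝ (Fin m) × X ↦
        TotalSpace.mk' (F := E →L[ℝ] E →L[ℝ] ℝ)
          (E := fun x : X ↦ TangentSpace I x →L[ℝ] TangentSpace I x →L[ℝ] ℝ) p.2
          ((F p.1).h.inner p.2)) (Metric.ball 0 δ ×ˢ univ))
    (hk : ContMDiffOn (𝓘(ℝ, EuclideanSpace ℝ (Fin m)).prod I) (I.prod 𝓘(ℝ, E →L[ℝ] E →L[ℝ] ℝ)) ∞
      (fun p : EuclideanSpace ℝ (Fin m) × X ↦
        TotalSpace.mk' (F := E →L[ℝ] E →L[ℝ] ℝ)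
          (E := fun x : X ↦ TangentSpace I x →L[ℝ] TangentSpace I x →L[ℝ] ℝ) p.2 ((F p.1).k p.2))
      (Metric.ball 0 δ ×ˢ univ)) :
    InitialDataSet.IsSmoothDataFamily m (F ∘ squash m δ) := by
  have hsm : ContMDiff (𝓘(ℝ, EuclideanSpace ℝ (Fin m)).prod I)
      (𝓘(ℝ, EuclideanSpace ℝ (Fin m)).prod I) ∞
      (fun p : EuclideanSpace ℝ (Fin m) × X ↦ (squash m δ p.1, p.2)) :=
    ((contDiff_squash m δ).contMDiff.comp contMDiff_fst).prodMk contMDiff_snd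
  have hmaps : ∀ p : EuclideanSpace ℝ (Fin m) × X,
      (squash m δ p.1, p.2) ∈ (Metric.ball (0 : EuclideanSpace ℝ (Fin m)) δ) ×ˢ (univ : Set X) :=
    fun p ↦ ⟨by simpa using norm_squash_lt hδ p.1, trivial⟩
  exact ⟨hh.comp_contMDiff hsm hmaps, hk.comp_contMDiff hsm hmaps⟩

/-- **Local escape suffices (normal form of Christodoulou-genericity).** To show that `𝓔` has
codimension `≥ m` in `𝓓` it is enough to find, through every `d ∈ 𝓔`, a family which is jointly
smooth, injective, admissible and non-exceptional merely for parameters in some ball `B(0, δ)`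
(joint smoothness being asked only on `B(0, δ) × X`); the global family demanded by
`HasCodimAtLeastIn` is obtained by the squash reparametrisation `c ↦ δ c / √(1 + ‖c‖²)` of `ℝᵐ`
onto the ball. Conversely a global escape restricts to a local one, so this is an equivalent
formulation of `HasCodimAtLeastIn`. -/
theorem hasCodimAtLeastIn_of_local {𝓓 𝓔 : Set (InitialDataSet I X)} {m : ℕ}
    (h : ∀ d ∈ 𝓔, ∃ (F : EuclideanSpace ℝ (Fin m) → InitialDataSet I X) (δ : ℝ), 0 < δ ∧
      ContMDiffOn (𝓘(ℝ, EuclideanSpace ℝ (Fin m)).prod I) (I.prod 𝓘(ℝ, E →L[ℝ] E →L[ℝ] ℝ)) ∞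
        (fun p : EuclideanSpace ℝ (Fin m) × X ↦
          TotalSpace.mk' (F := E →L[ℝ] E →L[ℝ] ℝ)
            (E := fun x : X ↦ TangentSpace I x →L[ℝ] TangentSpace I x →L[ℝ] ℝ) p.2
            ((F p.1).h.inner p.2)) (Metric.ball 0 δ ×ˢ univ) ∧
      ContMDiffOn (𝓘(ℝ, EuclideanSpace ℝ (Fin m)).prod I) (I.prod 𝓘(ℝ, E →L[ℝ] E →L[ℝ] ℝ)) ∞
        (fun p : EuclideanSpace ℝ (Fin m) × X ↦
          TotalSpace.mk' (F := E →L[ℝ] E →L[ℝ] ℝ)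
            (E := fun x : X ↦ TangentSpace I x →L[ℝ] TangentSpace I x →L[ℝ] ℝ) p.2 ((F p.1).k p.2))
        (Metric.ball 0 δ ×ˢ univ) ∧
      F 0 = d ∧ Set.InjOn F (Metric.ball 0 δ) ∧
      (∀ c ∈ Metric.ball (0 : EuclideanSpace ℝ (Fin m)) δ, F c ∈ 𝓓) ∧
      ∀ c ∈ Metric.ball (0 : EuclideanSpace ℝ (Fin m)) δ, c ≠ 0 → F c ∉ 𝓔) :
    InitialDataSet.HasCodimAtLeastIn 𝓓 𝓔 m := by
  intro d hd
  obtain ⟨F, δ, hδ, hh, hk, h0, hinj, hadm, hexc⟩ := h d hd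
  have hball : ∀ c, squash m δ c ∈ Metric.ball (0 : EuclideanSpace ℝ (Fin m)) δ := fun c ↦ by
    simpa using norm_squash_lt hδ c
  refine ⟨F ∘ squash m δ, isSmoothDataFamily_comp_squash hδ hh hk, by simp [squash_zero, h0],
    fun c c' hcc' ↦ squash_injective hδ (hinj (hball c) (hball c') hcc'), fun c ↦ hadm _ (hball c),
    fun c hc ↦ hexc _ (hball c) fun h' ↦ hc ((squash_eq_zero_iff hδ c).1 h')⟩

/-- **Local escape with a globally smooth family.** The frequent special case of
`hasCodimAtLeastIn_of_local` in which the family is already jointly smooth on all of `ℝᵐ × X`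
(e.g. affine in the parameter) and only injectivity, admissibility and goodness are known near
`0`. -/
theorem hasCodimAtLeastIn_of_local' {𝓓 𝓔 : Set (InitialDataSet I X)} {m : ℕ}
    (h : ∀ d ∈ 𝓔, ∃ (F : EuclideanSpace ℝ (Fin m) → InitialDataSet I X) (δ : ℝ), 0 < δ ∧
      InitialDataSet.IsSmoothDataFamily m F ∧ F 0 = d ∧ Set.InjOn F (Metric.ball 0 δ) ∧
      (∀ c ∈ Metric.ball (0 : EuclideanSpace ℝ (Fin m)) δ, F c ∈ 𝓓) ∧
      ∀ c ∈ Metric.ball (0 : EuclideanSpace ℝ (Fin m)) δ, c ≠ 0 → F c ∉ 𝓔) :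
    InitialDataSet.HasCodimAtLeastIn 𝓓 𝓔 m := by
  refine hasCodimAtLeastIn_of_local fun d hd ↦ ?_
  obtain ⟨F, δ, hδ, hF, h0, hinj, hadm, hexc⟩ := h d hd
  exact ⟨F, δ, hδ, hF.1.contMDiffOn, hF.2.contMDiffOn, h0, hinj, hadm, hexc⟩

/-- The converse restriction: a global escape is in particular a local one (`δ = 1`), so
`hasCodimAtLeastIn_of_local'` is an equivalent formulation. -/
theorem hasCodimAtLeastIn_iff_local {𝓓 𝓔 : Set (InitialDataSet I X)} {m : ℕ} :
    InitialDataSet.HasCodimAtLeastIn 𝓓 𝓔 m ↔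
    ∀ d ∈ 𝓔, ∃ (F : EuclideanSpace ℝ (Fin m) → InitialDataSet I X) (δ : ℝ), 0 < δ ∧
      InitialDataSet.IsSmoothDataFamily m F ∧ F 0 = d ∧ Set.InjOn F (Metric.ball 0 δ) ∧
      (∀ c ∈ Metric.ball (0 : EuclideanSpace ℝ (Fin m)) δ, F c ∈ 𝓓) ∧
      ∀ c ∈ Metric.ball (0 : EuclideanSpace ℝ (Fin m)) δ, c ≠ 0 → F c ∉ 𝓔 := by
  refine ⟨fun h d hd ↦ ?_, hasCodimAtLeastIn_of_local'⟩
  obtain ⟨F, hF, h0, hinj, hadm, hexc⟩ := h d hd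
  exact ⟨F, 1, one_pos, hF, h0, hinj.injOn, fun c _ ↦ hadm c, fun c _ hc ↦ hexc c hc⟩

/-! ### The abstract level-set trap: what a refuter must exhibit -/

/-- **The level-set trap.** Let `f` be a curve-continuous observable (continuous along every smooth
parameter curve of every smooth `m`-parameter family), `d ∈ 𝓔` with `f d = 0`, and
suppose the exceptional set `𝓔` contains the admissible zero set `{f = 0} ∩ 𝓓` and, for
arbitrarily small `ρ > 0`, the whole admissible level sets `{|f| = ρ} ∩ 𝓓`. Then `𝓔` has
codimension `0` in Christodoulou's scale: `HasCodimAtLeastIn 𝓓 𝓔 m` fails for EVERY `m ≥ 1`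
(intermediate value theorem along the coordinate line of any candidate family). This is the exact
shape of obstruction a refutation of a curve-generic statement must produce. -/
theorem not_hasCodimAtLeastIn_of_trap {𝓓 𝓔 : Set (InitialDataSet I X)} {m : ℕ} (hm : m ≠ 0)
    {f : InitialDataSet I X → ℝ}
    (hf : ∀ F : EuclideanSpace ℝ (Fin m) → InitialDataSet I X, InitialDataSet.IsSmoothDataFamily m F →
      ∀ γ : ℝ → EuclideanSpace ℝ (Fin m), ContMDiff 𝓘(ℝ, ℝ) 𝓘(ℝ, EuclideanSpace ℝ (Fin m)) ∞ γ →
        Continuous fun t ↦ f (F (γ t)))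
    {d : InitialDataSet I X}
    (hd : d ∈ 𝓔) (hfd : f d = 0) (hzero : ∀ d' ∈ 𝓓, f d' = 0 → d' ∈ 𝓔)
    (hlevel : ∀ ε > 0, ∃ ρ, 0 < ρ ∧ ρ < ε ∧ ∀ d' ∈ 𝓓, |f d'| = ρ → d' ∈ 𝓔) :
    ¬ InitialDataSet.HasCodimAtLeastIn 𝓓 𝓔 m := by
  intro h
  obtain ⟨F, hF, hF0, -, hadm, hexc⟩ := h d hd
  obtain ⟨i⟩ : Nonempty (Fin m) := ⟨⟨0, Nat.pos_of_ne_zero hm⟩⟩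
  set e₁ : EuclideanSpace ℝ (Fin m) := EuclideanSpace.single i 1 with he₁
  set ι : ℝ → EuclideanSpace ℝ (Fin m) := fun t ↦ t • e₁ with hι
  have hιi : ∀ t, ι t i = t := fun t ↦ by simp [hι, he₁]
  have hιne : ∀ t ≠ 0, ι t ≠ 0 := fun t ht h ↦ ht (by rw [← hιi t, h]; rfl)
  have hιz : ι 0 = 0 := by simp [hι]
  have hιs : ContMDiff 𝓘(ℝ, ℝ) 𝓘(ℝ, EuclideanSpace ℝ (Fin m)) ∞ ι :=
    (contDiff_id.smul contDiff_const).contMDiff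
  set g : ℝ → ℝ := fun t ↦ |f (F (ι t))| with hg
  have hgc : Continuous g := (hf F hF ι hιs).abs
  have hg0 : g 0 = 0 := by simp [hg, hιz, hF0, hfd]
  have hg1 : g 1 ≠ 0 := by
    intro h1
    have h1' : f (F (ι 1)) = 0 := by simpa [hg] using h1
    exact hexc (ι 1) (hιne 1 one_ne_zero) (hzero _ (hadm _) h1')
  have hg1pos : 0 < g 1 := lt_of_le_of_ne (abs_nonneg _) (Ne.symm hg1)
  obtain ⟨ρ, hρ, hρlt, hρlevel⟩ := hlevel (g 1) hg1pos
  obtain ⟨t, ht, hgt⟩ :=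
    intermediate_value_Icc zero_le_one hgc.continuousOn ⟨by rw [hg0]; exact hρ.le, hρlt.le⟩
  have ht0 : t ≠ 0 := by
    rintro rfl
    rw [hg0] at hgt
    exact hρ.ne hgt
  exact hexc (ι t) (hιne t ht0) (hρlevel _ (hadm _) hgt)

end Abstract

/-! ### The model of `GenericityAndFails`: the conjunction has codimension `0` for every `m` -/

/-- Continuity of `t ↦ k_{γ(t)}(p)(v, w)` along a smooth parameter curve `γ` in `ℝᵐ` for a smooth
`m`-parameter family of slice data (the case `m = 1` is `continuous_k_apply`). -/
theorem continuous_k_apply_fin {m : ℕ} {F : EuclideanSpace ℝ (Fin m) → SliceData}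
    (hF : InitialDataSet.IsSmoothDataFamily m F) {γ : ℝ → EuclideanSpace ℝ (Fin m)}
    (hγ : ContMDiff 𝓘(ℝ, ℝ) 𝓘(ℝ, EuclideanSpace ℝ (Fin m)) ∞ γ) (p : Minkowski.slice)
    (v w : E3) : Continuous fun t ↦ (F (γ t)).k p v w := by
  have h1 : ContMDiff 𝓘(ℝ, ℝ) ((𝓘(ℝ, EuclideanSpace ℝ (Fin m))).prod 𝓘(ℝ, E3)) ∞
      (fun t ↦ (γ t, p)) := hγ.prodMk contMDiff_const
  have h2 : ContMDiff 𝓘(ℝ, ℝ) (𝓘(ℝ, E3).prod 𝓘(ℝ, Bil)) ∞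
      (fun t ↦ TotalSpace.mk' Bil
        (E := fun y : Minkowski.slice ↦
          TangentSpace 𝓘(ℝ, E3) y →L[ℝ] TangentSpace 𝓘(ℝ, E3) y →L[ℝ] ℝ) p
            (kBil (F (γ t)) p)) :=
    hF.2.comp h1
  have h3 : ContMDiff 𝓘(ℝ, ℝ) 𝓘(ℝ, Bil) ∞ (fun t ↦ kBil (F (γ t)) p) := fun t ↦
    ((contMDiffAt_totalSpace_bilin_iff Minkowski.slice (fun _ ↦ p)
      (fun t ↦ kBil (F (γ t)) p) t).1 (h2 t)).2
  exact (h3.continuous.clm_apply continuous_const).clm_apply continuous_const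

/-- The squared radius of the observable is curve-continuous for every `m`. -/
theorem continuous_radiusSq {m : ℕ} (F : EuclideanSpace ℝ (Fin m) → SliceData)
    (hF : InitialDataSet.IsSmoothDataFamily m F) (γ : ℝ → EuclideanSpace ℝ (Fin m))
    (hγ : ContMDiff 𝓘(ℝ, ℝ) 𝓘(ℝ, EuclideanSpace ℝ (Fin m)) ∞ γ) :
    Continuous fun t ↦ (Φ (F (γ t))).1 ^ 2 + (Φ (F (γ t))).2 ^ 2 :=
  ((continuous_k_apply_fin hF hγ p₀ e e).pow 2).add ((continuous_k_apply_fin hF hγ p₁ e e).pow 2)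

/-- **The conjunction `P ∧ Q` of `GenericityAndFails` has codimension `0`**: its exceptional set has
codimension `≥ m` for NO `m ≥ 1` (while `P`, `Q` separately have codimension `≥ 1`). No finite
number of parameters rescues the glue principle. -/
theorem not_isChristodoulouGeneric_P_and_Q_codim {m : ℕ} (hm : m ≠ 0) :
    ¬ InitialDataSet.IsChristodoulouGeneric (Set.univ : Set SliceData)
      (fun D ↦ D ∈ goodP ∧ D ∈ goodQ) m := by
  refine not_hasCodimAtLeastIn_of_trap hm (f := fun D : SliceData ↦ (Φ D).1 ^ 2 + (Φ D).2 ^ 2)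
    continuous_radiusSq (d := trivialData)
    ⟨trivial, fun h ↦ h.1 (Or.inl Φ_trivialData)⟩ (by simp [Φ_trivialData]) ?_ ?_
  · -- the zero set: `Φ D = 0` is exceptional for `P`
    intro D _ hD
    refine ⟨trivial, fun h ↦ h.1 (Or.inl ?_)⟩
    have h1 : (Φ D).1 = 0 := by nlinarith [sq_nonneg (Φ D).1, sq_nonneg (Φ D).2]
    have h2 : (Φ D).2 = 0 := by nlinarith [sq_nonneg (Φ D).1, sq_nonneg (Φ D).2]
    exact Prod.ext h1 h2
  · -- whole small circles are exceptional
    intro ε hε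
    obtain ⟨n, hn⟩ := exists_nat_one_div_lt hε
    refine ⟨rad n ^ 2, pow_pos (rad_pos n) 2, ?_, fun D _ hD ↦ ?_⟩
    · have h1 : rad n ^ 2 ≤ rad n := by
        rw [sq]; exact mul_le_of_le_one_left (rad_pos n).le (rad_le_one n)
      exact lt_of_le_of_lt h1 hn
    · rw [abs_of_nonneg (by positivity)] at hD
      have hcirc : Φ D ∈ circle n := hD
      refine ⟨trivial, fun h ↦ ?_⟩
      rcases le_or_gt 0 (Φ D).2 with h2 | h2
      · exact h.1 (Or.inr ⟨n, hcirc, h2⟩)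
      · exact h.2 ⟨n, hcirc, h2⟩

/-- Summary: `P`, `Q` Christodoulou-generic with codimension `≥ 1`, but `P ∧ Q` generic for no
positive codimension. -/
theorem isChristodoulouGeneric_and_fails_all_codim :
    ∃ (P Q : SliceData → Prop),
      InitialDataSet.IsChristodoulouGeneric Set.univ P 1 ∧
      InitialDataSet.IsChristodoulouGeneric Set.univ Q 1 ∧
      ∀ m ≠ 0, ¬ InitialDataSet.IsChristodoulouGeneric Set.univ (fun D ↦ P D ∧ Q D) m :=
  ⟨(· ∈ goodP), (· ∈ goodQ), isChristodoulouGeneric_P, isChristodoulouGeneric_Q,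
    fun _ hm ↦ not_isChristodoulouGeneric_P_and_Q_codim hm⟩

end Summit.FinalStateConjecture.FinalStateConjecture.Theorems.TameCensorship.Negative

end
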